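import Literature.AlgebraicGeometry.AbelianVarieties.MarkmanPhiDescentTwistPullbackModel
import Literature.AlgebraicGeometry.AbelianVarieties.MarkmanBoxResolutions
import Summits.HodgeConjecture.HodgeConjecture.Theorems.VHCAbelianSchemesRoadOneNonJumpingPointOfInputsPlus
import HarnessLib

/-!
# Road №4 (`VHCAbelianSchemesRoad`), crux stmt-HodgeConjecture-26512 `DiagLocalOfMarkmanPinnedForall` — route «2T»: the `e₂`-ISOMORPHISM of
# SOCKET v2 for `Φ := Φ_T = (– ⊗ D′_s)⁺ ∘ Φ` AT A SECANT–QUOTIENT DATUM (placement P1), conditional on [GS]+[SP] and the box-of-resolutions comparison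

research route conditional on HC_CM; not a corollary; Q11.4-sentence-2 already refuted in dim ≥ 3.

Seat core-w5 g10 (claim-free; `--supports stmt-HodgeConjecture-26512 --as helper`; 0 new facts; director-hodge g21 R19.121 (2) ∕ R19.122 (2) ∕ R19.124 (A): «SECOND act:
`e₂_of_vbModel` in placement P1, `F₀ := F₀₁ ⊠ F₀₂`»). Socket v2 (`Theorems/VHCAbelianSchemesRoadOneNonJumpingPointOfBoxIsosPlus`) takes, for ONE
shift-commuting functor `Φ : D⁺(Mod_{A×B}) ⥤ D⁺(Mod_P)`, the isomorphism `e₂ : ι(Φ X₂) ≅ Q(q^*𝓓.E)` in `D(Mod_P)` at the box object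
`X₂ = ⟨Q(A.boxTensorComplex B R₂.P S₂.P), plus_Q_boxTensorComplex A B R₂ S₂⟩`. In placement P1 (`A = B = J`, `P = J × Ĵ = D.P`,
`Φ := Φ_T := markmanPhiDescentTwistPlus J …`, Literature `AbelianVarieties/MarkmanPhiDescentTwistPullbackModel`, `CommShift` by `commShiftMarkmanPhiDescentTwistPlus`)
this file delivers that `e₂` AT A SECANT–QUOTIENT DATUM `D` in two forms:

* §1 **`SecantQuotientDatum.e₂_of_thetaBoxIso`** — for EVERY `X ∈ D⁺(Mod_{J×J})` PRESENTED as `X ≅ ([Θ ⊠ Θ] ⊗)⁺(((π₁ × π₂)^*F₀)[0])`, `F₀` any coherent sheaf on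
  `J∕G₁ × J∕G₂`: `∃ E•` bounded VB complex on `Y`, `ι(Φ_T X) ≅ Q(quotientPullbackComplex D E•)`;
* §2 **`SecantQuotientDatum.e₂_of_boxResolutionsIso`** — THE SOCKET'S LITERAL `X₂`: inputs `F₀ := F₀₁ ⊠ F₀₂` (`F₀ᵢ` on `J∕Gᵢ` with strictly perfect resolutions
  `R₀ᵢ`, the box coherent), the resolutions `R₂ := 𝒪(Θ) ⊗ π₁^*R₀₁`, `S₂ := 𝒪(Θ) ⊗ π₂^*R₀₂` (`thetaPullbackResolution`, Literature `MarkmanBoxResolutions`) of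
  `G₂ = 𝒪(Θ) ⊗ π₁^*F₀₁`, `H₂ = 𝒪(Θ) ⊗ π₂^*F₀₂`, and
  `∃ E•, ι(Φ_T ⟨Q(J.boxTensorComplex J R₂.P S₂.P), plus_Q_boxTensorComplex J J R₂ S₂⟩) ≅ Q(quotientPullbackComplex D E•)` — GIVEN the comparison
  `eRes : Q(R₀₁• ⊠ R₀₂•) ≅ Q((F₀₁ ⊠ F₀₂)[0])` in `D(Mod_{J∕G₁ × J∕G₂})` (a HYPOTHESIS binder: «the external product of strictly perfect resolutions resolves the
  external product», Tor-independence over a field — not in the tree) and [GS]+[SP].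

The currency is the socket's verbatim (`HasDerivedCategory.standard`, `(J.prod J).X`, `D.P`, `D.Y`, `D.q`, `quotientPullbackComplex`, `plus_Q_boxTensorComplex`; all
identifications `rfl`), with `n := D.d + 1`, `#Gᵢ = D.cardᵢ` (so `card₁`, `card₂` ARE used, at (K5-D)). CONDITIONAL on exactly [GS] `Grothendieck_higherDirectImage_coh` +
[SP] `ThomasonTrobaugh_vbModel_of_boundedCoh` (hypotheses; the (m) MODEL) — and, for §2, on the binder `eRes`.

COSTUME: a HELPER toward the `e₂` binder of socket v2; STATUS-only; no stub is stated, restated or weakened; nothing touches `closes`, the skeleton, any stub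
or `PinnedTwistedDatum`. NOTHING here says (N-U♭), (N-U), (m) unconditionally, (π), the crux, №4, HC_AV, HC_CM or HC holds; HC_CM HELD, by name only; helper lane (width 0).
References: [cite: Markman2025SecantWeil, §9.3 p. 70 L35–47, Rem. 9.3.7 (p. 73)] [cite: Weibel1994, 10.5.2] [cite: EGAIII1, Thm. 3.2.1]
[cite: ThomasonTrobaugh1990, Prop. 2.3.1 (d)] [cite: StacksProject, Tag 0FXX and Tag 08II].
-/

noncomputable section

-- `TopCat.Presheaf`/`Scheme.Modules` are not reducible (as in Mathlib's `AlgebraicGeometry/Modules/Sheaf.lean`).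
set_option backward.isDefEq.respectTransparency false

open CategoryTheory CategoryTheory.Category CategoryTheory.Limits AlgebraicGeometry MonoidalCategory CartesianMonoidalCategory
open AlgebraicGeometry.Scheme.Modules

namespace Summit.HodgeConjecture.HodgeConjecture.Ring2.SemiregularRepresentatives

set_option linter.dupNamespace false -- the cell's namespace repeats the summit name, as in every `Ring2*` file

namespace SecantQuotientDatum

open Literature.AlgebraicGeometry Literature.AlgebraicGeometry.Motives Literature.AlgebraicGeometry.Motives.AbelianVariety
open Literature.AlgebraicGeometry.Modules Literature.AlgebraicGeometry.KTheory Literature.AlgebraicGeometry.AbelianVarieties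
open Literature.AlgebraicGeometry.Morphisms Literature.AlgebraicGeometry.Markman2025
open Summit.HodgeConjecture.HodgeConjecture.Ring2.SemiregularRepresentatives.NowhereDisplaceable (quotientPullbackComplex plus_Q_boxTensorComplex)

/-! ## §1 `e₂` from a `Θ ⊠ Θ`-presentation -/

/-- **The `e₂`-isomorphism of socket v2 for `Φ := Φ_T` at a secant–quotient datum, from a `Θ ⊠ Θ`-presentation** — CONDITIONAL on [GS]+[SP]:
for `D : SecantQuotientDatum`, exponents `s j m₁ m₂` with `2j+1 = d+1`, `(d+1)m₁ = 2s+j+1`, `(d+1)m₂ + j = 2s`, a coherent `F₀` on `J∕G₁ × J∕G₂`, and ANY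
`X ∈ D⁺(Mod_{J×J})` with `X ≅ ([Θ ⊠ Θ] ⊗)⁺(((π₁ × π₂)^*F₀)[0])`: there is a bounded complex `E•` of finite locally free `𝒪_Y`-modules with
`ι(Φ_T X) ≅ Q(q^*E•)` in `D(Mod_{J×Ĵ})`, `q^*E• = quotientPullbackComplex D E•`. (Literature `markmanPhiDescentTwist_pullback_vbModel_of_iso` at
`n := d+1`, `#Gᵢ = d+1`; `D.P = J × Ĵ`, `D.Y`, `D.q` unfold by `rfl`.) [cite: Markman2025SecantWeil, §9.3 Rem. 9.3.7 (p. 73)] [cite: Weibel1994, 10.5.2] -/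
theorem e₂_of_thetaBoxIso (hGS : Grothendieck_higherDirectImage_coh.{0, 1, 1}) (hSP : ThomasonTrobaugh_vbModel_of_boundedCoh.{1})
    (D : SecantQuotientDatum) {s j m₁ m₂ : ℕ} (hj : 2 * j + 1 = D.d + 1) (hm₁ : (D.d + 1) * m₁ = 2 * s + j + 1)
    (hm₂ : (D.d + 1) * m₂ + j = 2 * s)
    (F₀ : ((D.𝒥.J.torsionQuot D.succ_ne_zero D.G₁ D.G₁_le).X ⊗ (D.𝒥.J.torsionQuot D.succ_ne_zero D.G₂ D.G₂_le).X).left.Modules)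
    (hF₀ : Coh F₀) :
    letI := HasDerivedCategory.standard (D.𝒥.J.prod D.𝒥.J).X.left.Modules
    letI := HasDerivedCategory.standard D.P.X.left.Modules
    -- the same two instances in the `⊗`-spelling of the Literature layer (definitionally equal; instance search does not unfold `prod` ∕ `P`)
    letI := HasDerivedCategory.standard (D.𝒥.J.X ⊗ D.𝒥.J.X).left.Modules
    letI := HasDerivedCategory.standard (D.𝒥.J.X ⊗ (D.𝒥.J.dualOf D.Θ D.isAmple).X).left.Modules
    letI := HasDerivedCategory.standard ((D.𝒥.J.X ⊗ D.𝒥.J.X) ⊗ (D.𝒥.J.dualOf D.Θ D.isAmple).X).left.Modules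
    letI := HasDerivedCategory.standard
      ((secantQuotient D.𝒥.J D.isAmple D.G₁ D.G₂ D.succ_ne_zero D.G₁_le D.G₂_le).X ⊗ D.𝒥.J.X).left.Modules
    letI := HasDerivedCategory.standard (secantQuotient D.𝒥.J D.isAmple D.G₁ D.G₂ D.succ_ne_zero D.G₁_le D.G₂_le).X.left.Modules
    ∀ (X : DerivedCategory.Plus (D.𝒥.J.prod D.𝒥.J).X.left.Modules)
      (_ : X ≅ (haveI := additive_tensor_thetaBox D.𝒥.J (Θ := D.Θ)
        haveI := preservesFiniteLimits_tensor_thetaBox D.𝒥.J (Θ := D.Θ)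
        haveI := preservesFiniteColimits_tensor_thetaBox D.𝒥.J (Θ := D.Θ)
        ((tensorBifunctor (D.𝒥.J.X ⊗ D.𝒥.J.X).left).obj (thetaBox D.𝒥.J D.Θ)).mapDerivedCategoryPlus).obj
          ((DerivedCategory.Plus.singleFunctor _ 0).obj
            ((Scheme.Modules.pullback (quotientPairMap D.𝒥.J D.succ_ne_zero D.G₁ D.G₂ D.G₁_le D.G₂_le)).obj F₀))),
      ∃ (K : CochainComplex D.Y.X.left.Modules ℤ) (_ : IsBoundedVBComplex K),
        Nonempty (DerivedCategory.Plus.ι.obj ((markmanPhiDescentTwistPlus D.𝒥.J D.isAmple D.KTheta_eq_bot s j).obj X) ≅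
          DerivedCategory.Q.obj (quotientPullbackComplex D K)) := by
  intro X e
  -- the statement's instances, re-bound for instance search inside the proof
  letI := HasDerivedCategory.standard (D.𝒥.J.X ⊗ D.𝒥.J.X).left.Modules
  letI := HasDerivedCategory.standard (D.𝒥.J.X ⊗ (D.𝒥.J.dualOf D.Θ D.isAmple).X).left.Modules
  letI := HasDerivedCategory.standard ((D.𝒥.J.X ⊗ D.𝒥.J.X) ⊗ (D.𝒥.J.dualOf D.Θ D.isAmple).X).left.Modules
  letI := HasDerivedCategory.standard
    ((secantQuotient D.𝒥.J D.isAmple D.G₁ D.G₂ D.succ_ne_zero D.G₁_le D.G₂_le).X ⊗ D.𝒥.J.X).left.Modules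
  letI := HasDerivedCategory.standard (secantQuotient D.𝒥.J D.isAmple D.G₁ D.G₂ D.succ_ne_zero D.G₁_le D.G₂_le).X.left.Modules
  exact markmanPhiDescentTwist_pullback_vbModel_of_iso D.𝒥.J D.isAmple D.KTheta_eq_bot D.succ_ne_zero D.G₁ D.G₂ D.G₁_le D.G₂_le
    hGS hSP hj hm₁ hm₂ D.card₁ D.card₂ F₀ hF₀ X e

/-! ## §2 `e₂` at the socket's box object `⟨Q(R₂• ⊠ S₂•), plus_Q_boxTensorComplex⟩` for `R₂ = 𝒪(Θ) ⊗ π₁^*R₀₁`, `S₂ = 𝒪(Θ) ⊗ π₂^*R₀₂` -/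

/-- **The `e₂`-isomorphism of socket v2 AT ITS LITERAL BOX OBJECT, placement P1, inputs `F₀ := F₀₁ ⊠ F₀₂`** — CONDITIONAL on [GS]+[SP] and GIVEN the
comparison `eRes : Q(R₀₁• ⊠ R₀₂•) ≅ Q((F₀₁ ⊠ F₀₂)[0])` in `D(Mod_{J∕G₁ × J∕G₂})` (hypothesis: the external product of the strictly perfect resolutions `R₀ᵢ`
of `F₀ᵢ` resolves `F₀₁ ⊠ F₀₂` — Tor-independence over a field, not proved in the tree): for `R₂ := 𝒪(Θ) ⊗ π₁^*R₀₁`, `S₂ := 𝒪(Θ) ⊗ π₂^*R₀₂`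
(`thetaPullbackResolution`, strictly perfect resolutions of `𝒪(Θ) ⊗ πᵢ^*F₀ᵢ`), there is a bounded complex `E•` of finite locally free `𝒪_Y`-modules with
`ι(Φ_T ⟨Q(R₂• ⊠ S₂•), plus_Q_boxTensorComplex J J R₂ S₂⟩) ≅ Q(quotientPullbackComplex D E•)` in `D(Mod_{J×Ĵ})`. Proof: §1 at the presentation
`nonempty_thetaPullbackResolutions_box_plusIso` (Literature `MarkmanBoxResolutions`); `J.boxTensorComplex J` is `boxTensorComplex pr₁ pr₂` by `rfl`.
[cite: Markman2025SecantWeil, §9.3 p. 70 L35–47 and Rem. 9.3.7 (p. 73)] [cite: StacksProject, Tag 0FXX and Tag 08II] [cite: Weibel1994, 10.5.2] -/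
theorem e₂_of_boxResolutionsIso (hGS : Grothendieck_higherDirectImage_coh.{0, 1, 1}) (hSP : ThomasonTrobaugh_vbModel_of_boundedCoh.{1})
    (D : SecantQuotientDatum) {s j m₁ m₂ : ℕ} (hj : 2 * j + 1 = D.d + 1) (hm₁ : (D.d + 1) * m₁ = 2 * s + j + 1)
    (hm₂ : (D.d + 1) * m₂ + j = 2 * s)
    {F₀₁ : (D.𝒥.J.torsionQuot D.succ_ne_zero D.G₁ D.G₁_le).X.left.Modules} {F₀₂ : (D.𝒥.J.torsionQuot D.succ_ne_zero D.G₂ D.G₂_le).X.left.Modules}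
    (R₀₁ : StrictlyPerfectResolution F₀₁) (R₀₂ : StrictlyPerfectResolution F₀₂)
    (hF₀ : Coh (boxTensor (fst (D.𝒥.J.torsionQuot D.succ_ne_zero D.G₁ D.G₁_le).X (D.𝒥.J.torsionQuot D.succ_ne_zero D.G₂ D.G₂_le).X).left
      (snd (D.𝒥.J.torsionQuot D.succ_ne_zero D.G₁ D.G₁_le).X (D.𝒥.J.torsionQuot D.succ_ne_zero D.G₂ D.G₂_le).X).left F₀₁ F₀₂)) :
    letI := HasDerivedCategory.standard (D.𝒥.J.prod D.𝒥.J).X.left.Modules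
    letI := HasDerivedCategory.standard D.P.X.left.Modules
    letI := HasDerivedCategory.standard
      ((D.𝒥.J.torsionQuot D.succ_ne_zero D.G₁ D.G₁_le).X ⊗ (D.𝒥.J.torsionQuot D.succ_ne_zero D.G₂ D.G₂_le).X).left.Modules
    -- the `⊗`-spellings of the Literature layer (definitionally equal; instance search does not unfold `prod` ∕ `P`)
    letI := HasDerivedCategory.standard (D.𝒥.J.X ⊗ D.𝒥.J.X).left.Modules
    letI := HasDerivedCategory.standard (D.𝒥.J.X ⊗ (D.𝒥.J.dualOf D.Θ D.isAmple).X).left.Modules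
    letI := HasDerivedCategory.standard ((D.𝒥.J.X ⊗ D.𝒥.J.X) ⊗ (D.𝒥.J.dualOf D.Θ D.isAmple).X).left.Modules
    letI := HasDerivedCategory.standard
      ((secantQuotient D.𝒥.J D.isAmple D.G₁ D.G₂ D.succ_ne_zero D.G₁_le D.G₂_le).X ⊗ D.𝒥.J.X).left.Modules
    letI := HasDerivedCategory.standard (secantQuotient D.𝒥.J D.isAmple D.G₁ D.G₂ D.succ_ne_zero D.G₁_le D.G₂_le).X.left.Modules
    ∀ (_ : DerivedCategory.Q.obj (boxTensorComplex
          (fst (D.𝒥.J.torsionQuot D.succ_ne_zero D.G₁ D.G₁_le).X (D.𝒥.J.torsionQuot D.succ_ne_zero D.G₂ D.G₂_le).X).left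
          (snd (D.𝒥.J.torsionQuot D.succ_ne_zero D.G₁ D.G₁_le).X (D.𝒥.J.torsionQuot D.succ_ne_zero D.G₂ D.G₂_le).X).left R₀₁.P R₀₂.P) ≅
        DerivedCategory.Q.obj ((CochainComplex.singleFunctor _ 0).obj (boxTensor
          (fst (D.𝒥.J.torsionQuot D.succ_ne_zero D.G₁ D.G₁_le).X (D.𝒥.J.torsionQuot D.succ_ne_zero D.G₂ D.G₂_le).X).left
          (snd (D.𝒥.J.torsionQuot D.succ_ne_zero D.G₁ D.G₁_le).X (D.𝒥.J.torsionQuot D.succ_ne_zero D.G₂ D.G₂_le).X).left F₀₁ F₀₂))),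
      ∃ (K : CochainComplex D.Y.X.left.Modules ℤ) (_ : IsBoundedVBComplex K),
        Nonempty (DerivedCategory.Plus.ι.obj ((markmanPhiDescentTwistPlus D.𝒥.J D.isAmple D.KTheta_eq_bot s j).obj
            ⟨DerivedCategory.Q.obj (D.𝒥.J.boxTensorComplex D.𝒥.J (thetaPullbackResolution D.𝒥.J D.Θ D.succ_ne_zero D.G₁_le R₀₁).P
                (thetaPullbackResolution D.𝒥.J D.Θ D.succ_ne_zero D.G₂_le R₀₂).P),
              plus_Q_boxTensorComplex D.𝒥.J D.𝒥.J (thetaPullbackResolution D.𝒥.J D.Θ D.succ_ne_zero D.G₁_le R₀₁)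
                (thetaPullbackResolution D.𝒥.J D.Θ D.succ_ne_zero D.G₂_le R₀₂)⟩) ≅
          DerivedCategory.Q.obj (quotientPullbackComplex D K)) := by
  intro eRes
  letI := HasDerivedCategory.standard (D.𝒥.J.X ⊗ D.𝒥.J.X).left.Modules
  letI := HasDerivedCategory.standard (D.𝒥.J.X ⊗ (D.𝒥.J.dualOf D.Θ D.isAmple).X).left.Modules
  letI := HasDerivedCategory.standard ((D.𝒥.J.X ⊗ D.𝒥.J.X) ⊗ (D.𝒥.J.dualOf D.Θ D.isAmple).X).left.Modules
  letI := HasDerivedCategory.standard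
    ((secantQuotient D.𝒥.J D.isAmple D.G₁ D.G₂ D.succ_ne_zero D.G₁_le D.G₂_le).X ⊗ D.𝒥.J.X).left.Modules
  letI := HasDerivedCategory.standard (secantQuotient D.𝒥.J D.isAmple D.G₁ D.G₂ D.succ_ne_zero D.G₁_le D.G₂_le).X.left.Modules
  letI := HasDerivedCategory.standard
    ((D.𝒥.J.torsionQuot D.succ_ne_zero D.G₁ D.G₁_le).X ⊗ (D.𝒥.J.torsionQuot D.succ_ne_zero D.G₂ D.G₂_le).X).left.Modules
  obtain ⟨e⟩ := nonempty_thetaPullbackResolutions_box_plusIso D.𝒥.J D.Θ D.succ_ne_zero D.G₁ D.G₂ D.G₁_le D.G₂_le R₀₁ R₀₂ eRes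
    (plus_Q_boxTensorComplex D.𝒥.J D.𝒥.J (thetaPullbackResolution D.𝒥.J D.Θ D.succ_ne_zero D.G₁_le R₀₁)
      (thetaPullbackResolution D.𝒥.J D.Θ D.succ_ne_zero D.G₂_le R₀₂))
  exact e₂_of_thetaBoxIso hGS hSP D hj hm₁ hm₂ _ hF₀ _ e

end SecantQuotientDatum

end Summit.HodgeConjecture.HodgeConjecture.Ring2.SemiregularRepresentatives

end
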